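import Mathlib
import Summits.Ventures.PercRepro.TriangleCapFourthBandWitnessesF
import Summits.Ventures.PercRepro.TriangleCapRegimes

/-!
# PercRepro — THE TOP TWENTY-FIVE VALUES OF THE `K₄⁻`-FREE CHERRY TABLE: THE FIRST FOUR LAYERS (p3, gen 50; part 228)

`pair_count_spectrum_four` (`s ≥ 21`): a triangle-free graph with `s` edges has `Σ d²` at the star value, in the
`Δ = s − 1` band (`j ≤ 1`), the `Δ = s − 2` band (`j ≤ 3`), the `Δ = s − 3` band (`j ≤ 6`), the `Δ = s − 4` band
`s (s + 1) − 8 (s − 5) − 2 j` (`j ≤ 10`), or at most `s (s + 1) − 10 (s − 6)` (the level-four stability) — and for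
`s ≥ 21` the bands and the tail are disjoint.  On the cell (`bipSub_gap_four_layers`, `cherry_top_twentyfive`,
`5 ≤ a`, `21 ≤ r`, `2 a + r ≤ k`, `10 (r − 6) ≤ stabGapFull k a r` — e.g. `2 a + 5 r ≤ k`,
`cherry_top_twentyfive_of_k`): a `K₄⁻`-free graph strictly within `10 (r − 6)` of the closed form sits at one of the
`1 + 2 + 4 + 7 + 11 = 25` values, and each is attained — the first four layers of the table are complete.

Axioms: standard.
-/

namespace PercRepro

namespace TriangleCap

namespace C047

open Finset

variable {V : Type*} [Fintype V] [DecidableEq V]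

/-- **THE SPECTRUM DOWN TO THE `Δ = s − 4` LAYER** (`s ≥ 21`). -/
theorem pair_count_spectrum_four (H : SimpleGraph V) [DecidableRel H.Adj] (hfree : H.CliqueFree 3) (s : ℕ)
    (hs : 21 ≤ s) (hm : H.edgeFinset.card = s) :
    ∑ v, deg H v * deg H v = s * (s + 1) ∨
      (∃ j, j ≤ 1 ∧ ∑ v, deg H v * deg H v + 2 * (s - 2) + 2 * j = s * (s + 1)) ∨
      (∃ j, j ≤ 3 ∧ ∑ v, deg H v * deg H v + 4 * (s - 3) + 2 * j = s * (s + 1)) ∨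
      (∃ j, j ≤ 6 ∧ ∑ v, deg H v * deg H v + 6 * (s - 4) + 2 * j = s * (s + 1)) ∨
      (∃ j, j ≤ 10 ∧ ∑ v, deg H v * deg H v + 8 * (s - 5) + 2 * j = s * (s + 1)) ∨
      ∑ v, deg H v * deg H v + 10 * (s - 6) ≤ s * (s + 1) := by
  obtain ⟨w, hwmax, hcard, j, hj, hlayer⟩ := pair_count_layer H hfree (by omega)
  rw [hm] at hcard hlayer
  obtain ⟨t, ht⟩ : ∃ t, (offEdges H w).card = t := ⟨_, rfl⟩
  rw [ht] at hcard hj hlayer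
  by_cases ht4 : t ≤ 4
  · interval_cases t
    · left
      simp only [zero_mul, mul_zero, add_zero] at hlayer
      have : j = 0 := by omega
      rw [this] at hlayer
      simpa using hlayer
    · right; left
      refine ⟨j, by omega, ?_⟩
      have e : deg H w - 1 = s - 2 := by omega
      rw [e, one_mul] at hlayer
      exact hlayer
    · right; right; left
      refine ⟨j, by omega, ?_⟩
      have e : 2 * (deg H w - 1) = 2 * (s - 3) := by omega
      rw [e, ← mul_assoc] at hlayer
      exact hlayer
    · right; right; right; left
      refine ⟨j, by omega, ?_⟩
      have e : 3 * (deg H w - 1) = 3 * (s - 4) := by omega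
      rw [e, ← mul_assoc] at hlayer
      exact hlayer
    · right; right; right; right; left
      refine ⟨j, by omega, ?_⟩
      have e : 4 * (deg H w - 1) = 4 * (s - 5) := by omega
      rw [e, ← mul_assoc] at hlayer
      exact hlayer
  · right; right; right; right; right
    have hΔ : ∀ v, deg H v + 4 + 1 ≤ H.edgeFinset.card := fun v => by
      have := hwmax v
      omega
    have := sum_deg_sq_le_of_maxdeg_level H hfree 4 (by omega) hΔ
    rw [hm] at this
    have e : 2 * ((4 + 1) * (s - 4 - 2)) = 10 * (s - 6) := by omega
    rw [e] at this
    exact this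

/-- **THE GAP OF A BIPARTITE GRAPH IS A VALUE OF THE FIRST FOUR LAYERS OR BELOW** (`r ≥ 21`, `r + 1 ≤ k`). -/
theorem bipSub_gap_four_layers (D : SimpleGraph V) [DecidableRel D.Adj] (A : Finset V) (hD : BipSub D A)
    (a r : ℕ) (hA : A.card = a) (hm : D.edgeFinset.card + r = a * (Fintype.card V - a)) (hr : 21 ≤ r)
    (hk : r + 1 ≤ Fintype.card V) :
    ∑ v, deg D v * deg D v + r * (Fintype.card V - 1 - r) = D.edgeFinset.card * Fintype.card V ∨
      (∃ j, j ≤ 1 ∧ ∑ v, deg D v * deg D v + r * (Fintype.card V - 1 - r) + (2 * (r - 2) + 2 * j) =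
        D.edgeFinset.card * Fintype.card V) ∨
      (∃ j, j ≤ 3 ∧ ∑ v, deg D v * deg D v + r * (Fintype.card V - 1 - r) + (4 * (r - 3) + 2 * j) =
        D.edgeFinset.card * Fintype.card V) ∨
      (∃ j, j ≤ 6 ∧ ∑ v, deg D v * deg D v + r * (Fintype.card V - 1 - r) + (6 * (r - 4) + 2 * j) =
        D.edgeFinset.card * Fintype.card V) ∨
      (∃ j, j ≤ 10 ∧ ∑ v, deg D v * deg D v + r * (Fintype.card V - 1 - r) + (8 * (r - 5) + 2 * j) =
        D.edgeFinset.card * Fintype.card V) ∨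
      ∑ v, deg D v * deg D v + r * (Fintype.card V - 1 - r) + 10 * (r - 6) ≤
        D.edgeFinset.card * Fintype.card V := by
  have hH := bipSub_sum_deg_sq_add_disjEdgePairs D A hD a r hA hm hk
  have hr' : (missingGraph D A).edgeFinset.card = r := card_edges_missingGraph D A hD a r hA hm
  have hid := sum_deg_sq_add_disjEdgePairs (missingGraph D A)
  rw [hr'] at hid
  have hfree := cliqueFree_of_bipSub _ A (bipSub_missingGraph D A)
  rcases pair_count_spectrum_four (missingGraph D A) hfree r hr hr' with h | ⟨j, hj, h⟩ | ⟨j, hj, h⟩ |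
    ⟨j, hj, h⟩ | ⟨j, hj, h⟩ | h
  · left; omega
  · right; left; exact ⟨j, hj, by omega⟩
  · right; right; left; exact ⟨j, hj, by omega⟩
  · right; right; right; left; exact ⟨j, hj, by omega⟩
  · right; right; right; right; left; exact ⟨j, hj, by omega⟩
  · right; right; right; right; right; omega

/-- **THE TOP TWENTY-FIVE VALUES OF THE CHERRY TABLE:** for `5 ≤ a`, `21 ≤ r`, `2 a + r ≤ k`,
`10 (r − 6) ≤ stabGapFull k a r`, a `K₄⁻`-free graph strictly within `10 (r − 6)` of the closed form sits at one of
the twenty-five values `closed − g`, `g ∈ {0, 2 (r − 2), 2 (r − 1)} ∪ {4 (r − 3) + 2 j : j ≤ 3} ∪ {6 (r − 4) + 2 j : j ≤ 6}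
∪ {8 (r − 5) + 2 j : j ≤ 10}`, and each of the twenty-five is attained. -/
theorem cherry_top_twentyfive (k a r : ℕ) (ha5 : 5 ≤ a) (hr21 : 21 ≤ r) (hk : 2 * a + r ≤ k)
    (hgap : 10 * (r - 6) ≤ stabGapFull k a r) :
    (∀ (D : SimpleGraph (Fin k)) [DecidableRel D.Adj], K4mFree D → D.edgeFinset.card + r = a * (k - a) →
        D.edgeFinset.card * k < ∑ v, deg D v * deg D v + r * (k - 1 - r) + 10 * (r - 6) →
        ∃ g ∈ ({0, 2 * (r - 2), 2 * (r - 1), 4 * (r - 3), 4 * (r - 3) + 2, 4 * (r - 3) + 4, 4 * (r - 3) + 6, 6 * (r - 4), 6 * (r - 4) + 2, 6 * (r - 4) + 4, 6 * (r - 4) + 6, 6 * (r - 4) + 8, 6 * (r - 4) + 10, 6 * (r - 4) + 12, 8 * (r - 5), 8 * (r - 5) + 2, 8 * (r - 5) + 4, 8 * (r - 5) + 6, 8 * (r - 5) + 8, 8 * (r - 5) + 10, 8 * (r - 5) + 12, 8 * (r - 5) + 14, 8 * (r - 5) + 16, 8 * (r - 5) + 18, 8 * (r - 5) + 20} : Finset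 ℕ),
          ∑ v, deg D v * deg D v + r * (k - 1 - r) + g = D.edgeFinset.card * k) ∧
      (∀ g ∈ ({0, 2 * (r - 2), 2 * (r - 1), 4 * (r - 3), 4 * (r - 3) + 2, 4 * (r - 3) + 4, 4 * (r - 3) + 6, 6 * (r - 4), 6 * (r - 4) + 2, 6 * (r - 4) + 4, 6 * (r - 4) + 6, 6 * (r - 4) + 8, 6 * (r - 4) + 10, 6 * (r - 4) + 12, 8 * (r - 5), 8 * (r - 5) + 2, 8 * (r - 5) + 4, 8 * (r - 5) + 6, 8 * (r - 5) + 8, 8 * (r - 5) + 10, 8 * (r - 5) + 12, 8 * (r - 5) + 14, 8 * (r - 5) + 16, 8 * (r - 5) + 18, 8 * (r - 5) + 20} : Finset ℕ),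
        ∃ (D : SimpleGraph (Fin k)) (_ : DecidableRel D.Adj), K4mFree D ∧ D.edgeFinset.card + r = a * (k - a) ∧
          ∑ v, deg D v * deg D v + r * (k - 1 - r) + g = D.edgeFinset.card * k) := by
  have hcard : Fintype.card (Fin k) = k := Fintype.card_fin k
  have hk3 : a = 3 → r + 7 ≤ k := fun h => by omega
  refine ⟨?_, ?_⟩
  · intro D _ hK hm hlt
    have hbip : ∃ A : Finset (Fin k), A.card = a ∧ BipSub D A := by
      by_contra hnb
      have h := (stab_table_rows_ge_three k a r (by omega) hk (by omega) hk3).1 D hK hm hnb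
      omega
    obtain ⟨A, hA, hB⟩ := hbip
    have hl := bipSub_gap_four_layers D A hB a r hA (by rw [hcard]; exact hm) hr21 (by rw [hcard]; omega)
    rw [hcard] at hl
    simp only [mem_insert, mem_singleton]
    rcases hl with h | ⟨j, hj, h⟩ | ⟨j, hj, h⟩ | ⟨j, hj, h⟩ | ⟨j, hj, h⟩ | h
    · exact ⟨0, by simp, by rw [add_zero]; exact h⟩
    · interval_cases j
      · exact ⟨2 * (r - 2), by simp, by rw [mul_zero, add_zero] at h; exact h⟩
      · exact ⟨2 * (r - 1), by simp, by omega⟩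
    · interval_cases j
      · exact ⟨4 * (r - 3), by simp, by rw [mul_zero, add_zero] at h; exact h⟩
      · exact ⟨4 * (r - 3) + 2, by simp, by omega⟩
      · exact ⟨4 * (r - 3) + 4, by simp, by omega⟩
      · exact ⟨4 * (r - 3) + 6, by simp, by omega⟩
    · interval_cases j
      · exact ⟨6 * (r - 4), by simp, by rw [mul_zero, add_zero] at h; exact h⟩
      · exact ⟨6 * (r - 4) + 2, by simp, by omega⟩
      · exact ⟨6 * (r - 4) + 4, by simp, by omega⟩
      · exact ⟨6 * (r - 4) + 6, by simp, by omega⟩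
      · exact ⟨6 * (r - 4) + 8, by simp, by omega⟩
      · exact ⟨6 * (r - 4) + 10, by simp, by omega⟩
      · exact ⟨6 * (r - 4) + 12, by simp, by omega⟩
    · interval_cases j
      · exact ⟨8 * (r - 5), by simp, by rw [mul_zero, add_zero] at h; exact h⟩
      · exact ⟨8 * (r - 5) + 2, by simp, by omega⟩
      · exact ⟨8 * (r - 5) + 4, by simp, by omega⟩
      · exact ⟨8 * (r - 5) + 6, by simp, by omega⟩
      · exact ⟨8 * (r - 5) + 8, by simp, by omega⟩
      · exact ⟨8 * (r - 5) + 10, by simp, by omega⟩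
      · exact ⟨8 * (r - 5) + 12, by simp, by omega⟩
      · exact ⟨8 * (r - 5) + 14, by simp, by omega⟩
      · exact ⟨8 * (r - 5) + 16, by simp, by omega⟩
      · exact ⟨8 * (r - 5) + 18, by simp, by omega⟩
      · exact ⟨8 * (r - 5) + 20, by simp, by omega⟩
    · omega
  · intro g hg
    simp only [mem_insert, mem_singleton] at hg
    rcases hg with rfl | rfl | rfl | rfl | rfl | rfl | rfl | rfl | rfl | rfl | rfl | rfl | rfl | rfl | rfl | rfl | rfl | rfl | rfl | rfl | rfl | rfl | rfl | rfl | rfl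
    · have hK := k4mFree_bipMinusStar k a r
      have hE := card_edges_bipMinusStar k a r (by omega) (by omega)
      have hS := sum_deg_sq_bipMinusStar k a r (by omega) (by omega) (by omega)
      rw [hcard] at hS
      exact ⟨bipMinusStar k a r, inferInstance, hK, hE, by rw [add_zero]; exact hS⟩
    · obtain ⟨D, inst, A, hK, -, -, -, hE, hS⟩ := broom_value k a r (by omega) (by omega) (by omega)
      have hE' : D.edgeFinset.card + r = a * (k - a) := by
        have : r ≤ a * (k - a) := by
          have h2 : 1 * (k - a) ≤ a * (k - a) := Nat.mul_le_mul_right _ (by omega)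
          omega
        omega
      refine ⟨D, inst, hK, hE', ?_⟩
      rw [hE]
      exact hS
    · obtain ⟨hK, hE, hS⟩ := starPlusPair_value k a r (by omega) (by omega) (by omega)
      exact ⟨starPlusPair k a r (by omega), inferInstance, hK, hE, hS⟩
    · obtain ⟨hK, hE, hS⟩ := twoPairsAtLeaf_value k a r (by omega) (by omega) (by omega) (by omega)
      exact ⟨twoPairsAtLeaf k a r (by omega) (by omega) (by omega), inferInstance, hK, hE, hS⟩
    · obtain ⟨hK, hE, hS⟩ := twoPairsAtTwoLeaves_value k a r (by omega) (by omega) (by omega) (by omega)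
      exact ⟨twoPairsAtTwoLeaves k a r (by omega) (by omega) (by omega) (by omega), inferInstance, hK, hE, hS⟩
    · obtain ⟨hK, hE, hS⟩ := pairAtLeafPlusPair_value k a r (by omega) (by omega) (by omega) (by omega)
      exact ⟨pairAtLeafPlusPair k a r (by omega) (by omega) (by omega), inferInstance, hK, hE, hS⟩
    · obtain ⟨hK, hE, hS⟩ := twoPairsOff_value k a r (by omega) (by omega) (by omega) (by omega)
      exact ⟨twoPairsOff k a r (by omega) (by omega), inferInstance, hK, hE, hS⟩
    · obtain ⟨hK, hE, hS⟩ := threePairsAtVertex_value k a r (by omega) (by omega) (by omega) (by omega)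
      exact ⟨threePairsAtVertex k a r (by omega) (by omega) (by omega) (by omega), inferInstance, hK, hE, hS⟩
    · obtain ⟨hK, hE, hS⟩ := threePairsPath_value k a r (by omega) (by omega) (by omega) (by omega)
      exact ⟨threePairsPath k a r (by omega) (by omega) (by omega), inferInstance, hK, hE, hS⟩
    · obtain ⟨hK, hE, hS⟩ := twoPairsAtVertexPlusLeaf_value k a r (by omega) (by omega) (by omega) (by omega)
      exact ⟨twoPairsAtVertexPlusLeaf k a r (by omega) (by omega) (by omega), inferInstance, hK, hE, hS⟩
    · obtain ⟨hK, hE, hS⟩ := threePairsAtThreeLeaves_value k a r (by omega) (by omega) (by omega) (by omega)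
      exact ⟨threePairsAtThreeLeaves k a r (by omega) (by omega) (by omega) (by omega), inferInstance, hK, hE, hS⟩
    · obtain ⟨hK, hE, hS⟩ := twoLeavesPlusOff_value k a r (by omega) (by omega) (by omega) (by omega)
      exact ⟨twoLeavesPlusOff k a r (by omega) (by omega) (by omega) (by omega), inferInstance, hK, hE, hS⟩
    · obtain ⟨hK, hE, hS⟩ := oneLeafPlusTwoOff_value k a r (by omega) (by omega) (by omega) (by omega)
      exact ⟨oneLeafPlusTwoOff k a r (by omega) (by omega) (by omega) (by omega), inferInstance, hK, hE, hS⟩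
    · obtain ⟨hK, hE, hS⟩ := threePairsOff_value k a r (by omega) (by omega) (by omega) (by omega)
      exact ⟨threePairsOff k a r (by omega) (by omega) (by omega), inferInstance, hK, hE, hS⟩
    · obtain ⟨hK, hE, hS⟩ := fourPairsAtVertex_value k a r (by omega) (by omega) (by omega) (by omega)
      exact ⟨fourPairsAtVertex k a r (by omega) (by omega), inferInstance, hK, hE, by rw [mul_zero, add_zero] at hS; exact hS⟩
    · obtain ⟨hK, hE, hS⟩ := fourAtVertexOneOff_value k a r (by omega) (by omega) (by omega) (by omega)
      exact ⟨fourAtVertexOneOff k a r (by omega) (by omega), inferInstance, hK, hE, hS⟩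
    · obtain ⟨hK, hE, hS⟩ := fourAtVertexTwoOff_value k a r (by omega) (by omega) (by omega) (by omega)
      exact ⟨fourAtVertexTwoOff k a r (by omega) (by omega), inferInstance, hK, hE, hS⟩
    · obtain ⟨hK, hE, hS⟩ := fourAtVertexThreeOff_value k a r (by omega) (by omega) (by omega) (by omega)
      exact ⟨fourAtVertexThreeOff k a r (by omega) (by omega), inferInstance, hK, hE, hS⟩
    · obtain ⟨hK, hE, hS⟩ := fourAtVertexAllOff_value k a r (by omega) (by omega) (by omega) (by omega)
      exact ⟨fourAtVertexAllOff k a r (by omega), inferInstance, hK, hE, hS⟩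
    · obtain ⟨hK, hE, hS⟩ := twoAtVertexTwoLeaves_value k a r (by omega) (by omega) (by omega) (by omega)
      exact ⟨twoAtVertexTwoLeaves k a r (by omega) (by omega) (by omega) (by omega), inferInstance, hK, hE, hS⟩
    · obtain ⟨hK, hE, hS⟩ := twoAtVertexLeafOff_value k a r (by omega) (by omega) (by omega) (by omega)
      exact ⟨twoAtVertexLeafOff k a r (by omega) (by omega) (by omega) (by omega), inferInstance, hK, hE, hS⟩
    · obtain ⟨hK, hE, hS⟩ := leafOffLeafOff_value k a r (by omega) (by omega) (by omega) (by omega)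
      exact ⟨leafOffLeafOff k a r (by omega) (by omega) (by omega) (by omega), inferInstance, hK, hE, hS⟩
    · obtain ⟨hK, hE, hS⟩ := leafOffOffOff_value k a r (by omega) (by omega) (by omega) (by omega)
      exact ⟨leafOffOffOff k a r (by omega) (by omega) (by omega) (by omega), inferInstance, hK, hE, hS⟩
    · obtain ⟨hK, hE, hS⟩ := twoOffAtVertexTwoOff_value k a r (by omega) (by omega) (by omega) (by omega)
      exact ⟨twoOffAtVertexTwoOff k a r (by omega) (by omega) (by omega), inferInstance, hK, hE, hS⟩
    · obtain ⟨hK, hE, hS⟩ := fourPairsOff_value k a r (by omega) (by omega) (by omega) (by omega)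
      exact ⟨fourPairsOff k a r (by omega) (by omega) (by omega) (by omega), inferInstance, hK, hE, hS⟩

/-- `stabGapFull k a r ≥ 10 (r − 6)` for `3 ≤ a`, `1 ≤ r`, `2 a + 5 r ≤ k`. -/
theorem stabGapFull_ge_ten (k a r : ℕ) (ha3 : 3 ≤ a) (hr : 1 ≤ r) (hk : 2 * a + 5 * r ≤ k) :
    10 * (r - 6) ≤ stabGapFull k a r := by
  unfold stabGapFull
  by_cases h1 : r + 3 ≤ a
  · rw [if_pos h1]
    have hb1 : 5 * r - 1 ≤ k - 2 * a - 1 := by omega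
    have hb2 : 3 ≤ a - r := by omega
    have := Nat.mul_le_mul (Nat.mul_le_mul_left 2 hb1) hb2
    omega
  · rw [if_neg h1]
    by_cases h2 : r + 1 ≤ a
    · rw [if_pos h2]
      omega
    · rw [if_neg h2]
      apply le_min
      · have : 0 ≤ 2 * (r - a) * (a - 2) := Nat.zero_le _
        omega
      · have : 0 ≤ 2 * (r - a) * (a - 3) := Nat.zero_le _
        omega

/-- **THE TOP TWENTY-FIVE VALUES FOR `2 a + 5 r ≤ k`** (`5 ≤ a`, `21 ≤ r`). -/
theorem cherry_top_twentyfive_of_k (k a r : ℕ) (ha5 : 5 ≤ a) (hr21 : 21 ≤ r) (hk : 2 * a + 5 * r ≤ k) :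
    (∀ (D : SimpleGraph (Fin k)) [DecidableRel D.Adj], K4mFree D → D.edgeFinset.card + r = a * (k - a) →
        D.edgeFinset.card * k < ∑ v, deg D v * deg D v + r * (k - 1 - r) + 10 * (r - 6) →
        ∃ g ∈ ({0, 2 * (r - 2), 2 * (r - 1), 4 * (r - 3), 4 * (r - 3) + 2, 4 * (r - 3) + 4, 4 * (r - 3) + 6, 6 * (r - 4), 6 * (r - 4) + 2, 6 * (r - 4) + 4, 6 * (r - 4) + 6, 6 * (r - 4) + 8, 6 * (r - 4) + 10, 6 * (r - 4) + 12, 8 * (r - 5), 8 * (r - 5) + 2, 8 * (r - 5) + 4, 8 * (r - 5) + 6, 8 * (r - 5) + 8, 8 * (r - 5) + 10, 8 * (r - 5) + 12, 8 * (r - 5) + 14, 8 * (r - 5) + 16, 8 * (r - 5) + 18, 8 * (r - 5) + 20} : Finset ℕ),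
          ∑ v, deg D v * deg D v + r * (k - 1 - r) + g = D.edgeFinset.card * k) ∧
      (∀ g ∈ ({0, 2 * (r - 2), 2 * (r - 1), 4 * (r - 3), 4 * (r - 3) + 2, 4 * (r - 3) + 4, 4 * (r - 3) + 6, 6 * (r - 4), 6 * (r - 4) + 2, 6 * (r - 4) + 4, 6 * (r - 4) + 6, 6 * (r - 4) + 8, 6 * (r - 4) + 10, 6 * (r - 4) + 12, 8 * (r - 5), 8 * (r - 5) + 2, 8 * (r - 5) + 4, 8 * (r - 5) + 6, 8 * (r - 5) + 8, 8 * (r - 5) + 10, 8 * (r - 5) + 12, 8 * (r - 5) + 14, 8 * (r - 5) + 16, 8 * (r - 5) + 18, 8 * (r - 5) + 20} : Finset ℕ),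
        ∃ (D : SimpleGraph (Fin k)) (_ : DecidableRel D.Adj), K4mFree D ∧ D.edgeFinset.card + r = a * (k - a) ∧
          ∑ v, deg D v * deg D v + r * (k - 1 - r) + g = D.edgeFinset.card * k) :=
  cherry_top_twentyfive k a r ha5 hr21 (by omega) (stabGapFull_ge_ten k a r (by omega) (by omega) hk)

end C047

end TriangleCap

end PercRepro
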